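import Summits.Ventures.Crystal3D.Theorems.StickyWulffConstantCoaxialWallLawHealCap
import HarnessLib

/-!
# Cap-table row «ELEVEN occupied slots»: the twelfth contact is the tip (crux `CoaxialWallLaw`, stmt-Ventures-19481; line `WallLedgerF`,
# skeleton 'CoaxialWallLawCertificates' v8, incoherent side of the capping-closure split)

HONEST FRAMING. Venture `Summits/Ventures/Crystal3D` (cell `crystal3d-full`); an elementary cap-packing lemma for the crux `CoaxialWallLaw` (stmt-Ventures-19481,
`route-Ventures-StickyWulffConstant`), lane F T5b: the row «11 occupied ⇒ 0 off-tip contacts» of the healing-capacity table that the erosion bound of the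
incoherent half uses (`…HealCap` is the row «closed lower half-dozen ⇒ ≤ 2»).  Nothing about the stubs is claimed; F-C1 not moved.
* `eq_slotSite_two_of_eleven` — a heal-free direction (`…HealCap.HealFree`: inner product `≤ 1/2` with the nine slots of the closed lower half-dozen) that also
  avoids the upper slots `6` and `8` IS the upper slot `2` (axial component `≥ √2` from `HealFree.axis_ge`, the two upper constraints force `x₂ ≤ 0` and
  `−x₀ + x₁ ≥ √2`, Cauchy–Schwarz closes);
* `contact_eq_tip_of_eleven` — packing form: a ball with eleven frame slots occupied takes any further contact exactly at the twelfth slot.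
-/

noncomputable section

namespace Summit.Ventures.Crystal3D.Theorems

namespace TailResidue

open Summit.Ventures.Crystal3D Finset NearIdentity
open scoped InnerProductSpace

/-- **ELEVEN SLOTS**: a unit direction at inner product `≤ 1/2` with the nine slots of the closed lower half-dozen AND with the two upper slots `6, 8`
IS the remaining upper slot `2` — a ball with eleven of its twelve frame slots occupied receives a twelfth contact only at the empty slot (coherently);
cap-table row «11 occupied ⇒ 0 off-tip contacts». -/
theorem eq_slotSite_two_of_eleven {u : EuclideanSpace ℝ (Fin 3)} (h : HealFree u) (h6 : ⟪u, slotSite 6⟫_ℝ ≤ 1 / 2) (h8 : ⟪u, slotSite 8⟫_ℝ ≤ 1 / 2) :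
    u = slotSite 2 := by
  have hs : 0 < Real.sqrt 2 := by positivity
  have h2 : Real.sqrt 2 * Real.sqrt 2 = 2 := Real.mul_self_sqrt (by norm_num)
  have hT := h.axis_ge
  have hn := cubicCoords_sq_sum h.1
  have e6 : -cubicCoords u 0 + cubicCoords u 2 ≤ Real.sqrt 2 / 2 := by
    have := h6
    rw [inner_slotSite_right, div_le_iff₀ hs] at this
    simp only [slotInt, Matrix.cons_val_zero, Matrix.cons_val_one, Matrix.cons_val] at this
    norm_num at this
    nlinarith
  have e8 : cubicCoords u 1 + cubicCoords u 2 ≤ Real.sqrt 2 / 2 := by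
    have := h8
    rw [inner_slotSite_right, div_le_iff₀ hs] at this
    simp only [slotInt, Matrix.cons_val_zero, Matrix.cons_val_one, Matrix.cons_val] at this
    norm_num at this
    nlinarith
  -- `x₂ ≤ 0`, `−x₀ + x₁ ≥ √2`, Cauchy–Schwarz ⇒ equality
  have hx2 : cubicCoords u 2 ≤ 0 := by linarith
  have hd : Real.sqrt 2 ≤ -cubicCoords u 0 + cubicCoords u 1 := by linarith
  have hsq : (-cubicCoords u 0 + cubicCoords u 1) ^ 2 ≤ 2 * (cubicCoords u 0 ^ 2 + cubicCoords u 1 ^ 2) := by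
    nlinarith [sq_nonneg (cubicCoords u 0 + cubicCoords u 1)]
  have hc2 : cubicCoords (slotSite 2) = ![-(Real.sqrt 2 / 2), Real.sqrt 2 / 2, 0] := by
    rw [cubicCoords_slotSite]; ext i; fin_cases i <;> simp [slotVec, slotInt] <;> field_simp <;> nlinarith
  have hx2z : cubicCoords u 2 = 0 := by nlinarith [sq_nonneg (cubicCoords u 2)]
  have hsum : cubicCoords u 0 + cubicCoords u 1 = 0 := by nlinarith [sq_nonneg (cubicCoords u 0 + cubicCoords u 1)]
  have hx1 : cubicCoords u 1 = Real.sqrt 2 / 2 := by nlinarith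
  have hx0 : cubicCoords u 0 = -(Real.sqrt 2 / 2) := by linarith
  apply cubicCoords_injective
  rw [hc2]; ext i; fin_cases i
  · exact hx0
  · exact hx1
  · exact hx2z

open scoped Classical in
/-- **Cap-table row «eleven slots», packing form**: in a `1`-separated configuration, a ball `y` whose frame slots other than the upper slot `2` are all
occupied has every contact among those eleven balls or AT the tip `y + L(slotSite 2)`; in particular `deg y ≤ 12` with the twelfth contact coherent. -/
theorem contact_eq_tip_of_eleven {X : Finset (EuclideanSpace ℝ (Fin 3))} (hX : ∀ p ∈ X, ∀ q ∈ X, p ≠ q → 1 ≤ dist p q)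
    (L : EuclideanSpace ℝ (Fin 3) ≃ₗᵢ[ℝ] EuclideanSpace ℝ (Fin 3)) {y x : EuclideanSpace ℝ (Fin 3)}
    (hocc : ∀ k : Fin 12, k ≠ 2 → y + L (slotSite k) ∈ X) (hx : x ∈ X) (hd : dist y x = 1) (hne : ∀ k : Fin 12, k ≠ 2 → x ≠ y + L (slotSite k)) :
    x = y + L (slotSite 2) := by
  have hfree : HealFree (L.symm (x - y)) :=
    healFree_of_contact hX L (fun k hk => hocc k (by intro h; subst h; simp [lowerNine] at hk)) hx hd
      (fun k hk => hne k (by intro h; subst h; simp [lowerNine] at hk))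
  have hxy : ‖x - y‖ = 1 := by rw [← dist_eq_norm, dist_comm]; exact hd
  have key : ∀ k : Fin 12, k ≠ 2 → ⟪L.symm (x - y), slotSite k⟫_ℝ ≤ 1 / 2 := by
    intro k hk
    have h1 : ⟪L.symm (x - y), slotSite k⟫_ℝ = ⟪x - y, L (slotSite k)⟫_ℝ := by
      rw [← L.inner_map_map (L.symm (x - y)) (slotSite k), LinearIsometryEquiv.apply_symm_apply]
    rw [h1]
    refine inner_le_half_of_norm_sub_ge_one hxy (by rw [LinearIsometryEquiv.norm_map]; exact norm_eq_one_of_mem_fccSlots (slotSite_mem k)) ?_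
    have : x - y - L (slotSite k) = x - (y + L (slotSite k)) := by abel
    rw [this, ← dist_eq_norm]
    exact hX x hx _ (hocc k hk) (hne k hk)
  have heq := eq_slotSite_two_of_eleven hfree (key 6 (by decide)) (key 8 (by decide))
  have : x - y = L (slotSite 2) := by rw [← heq, LinearIsometryEquiv.apply_symm_apply]
  rw [← this]; abel

end TailResidue

end Summit.Ventures.Crystal3D.Theorems

end
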